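import Summits.CriticalPhenomena.Ising3DConformalLimit.Theses.FKParityRobustness
import Summits.CriticalPhenomena.Ising3DConformalLimit.Theorems.FKParityRobustnessIndependentStrandsJoinPinchToTetraReduction
import Summits.CriticalPhenomena.Ising3DConformalLimit.Theorems.FKParityRobustnessIndependentStrandsJoinLimitUpgrade
import Summits.CriticalPhenomena.Ising3DConformalLimit.Theorems.GapForcesFarMerging.Negative.IsingCertificate
import HarnessLib

/-!
# `OctaveTransfer` does not overshoot the crux: `IndependentStrandsJoin → OctaveTransfer`
# (registered sub-goal `stub_octaveCalibration`; line `pinch-to-tetra`)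

(crux item stmt-CriticalPhenomena-14625, route `FKParityRobustness`; lead `prover-line-stmt-CriticalPhenomena-14625-c2-0`,
2026-08-17; `--supports stmt-CriticalPhenomena-14625`.)  Pure glue, no definition.

The transfer stub of revision r2, `OctaveTransfer : ∀ ℓ, ∃ C > 0, ∀ L ≥ 1, thinRatio ℓ L ≤ C · Σ_{j ≤ ℓ} R4ratio (2^j L)`,
is implied by the crux itself: Aizenman's bound `U₄ ≥ -2⟨σσ⟩⟨σσ⟩` (field `aizenman` of the landed critical package
`softPackageNoBubble_criticalCorr`) gives `thinRatio ≤ 2` identically, Lebowitz gives `R4ratio ≥ 0`, and the crux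
gives `R4ratio L ≥ c` at EVERY scale `L ≥ 1` (`latticeBoundFromStrands_proof` with the proved `StrandsJoinBound`), so
`C = 2/c` works.  Together with the landed `independentStrandsJoin_of_limit_gap_pt_oct` (p140347):
**modulo `LimitExists`, `EnergyGapPowerLaw` and pinched transparency, `IndependentStrandsJoin ↔ OctaveTransfer`** —
the r2 transfer stub is exactly crux-sized (`independentStrandsJoin_iff_octaveTransfer`).
References: M. Aizenman, Comm. Math. Phys. 86 (1982), Prop. 5.3 and eq. (5.11) [AizenmanCMP1982].
-/

noncomputable section

open Finset
open Literature.Probability.LatticeModels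
open Summit.CriticalPhenomena.Ising3DConformalLimit.Theses.FKParityRobustness
open Summit.CriticalPhenomena.Ising3DConformalLimit.Theses.EnergyNotSigmaSquared (EnergyGapPowerLaw)
open Summit.CriticalPhenomena.Ising3DConformalLimit.Theorems.GapForcesFarMerging.Negative
  (cc2 up dn src PinchedTransparencyShape softPackageNoBubble_criticalCorr)
open Summit.CriticalPhenomena.Ising3DConformalLimit.Cruxes.ParityRobustMerging.PlaquetteXorSurgery (tetra)

namespace Summit.CriticalPhenomena.Ising3DConformalLimit.Cruxes.IndependentStrandsJoin.PinchToTetra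

/-- **`thinRatio ≤ 2`** identically (Aizenman: `U₄ ≥ -2⟨σ_{y₀}σ_{y₁}⟩⟨σ_{y₂}σ_{y₃}⟩` at the thin configuration, whose
`(01)(23)` pairing product is `Nthin`). [cite: AizenmanCMP1982, Prop. 5.3] -/
theorem thinRatio_le_two (ℓ L : ℕ) : thinRatio ℓ L ≤ 2 := by
  have hA := softPackageNoBubble_criticalCorr.aizenman ![0, dn (2 ^ ℓ * L), src L, up (2 ^ ℓ * L)]
  simp only [Matrix.cons_val_zero, Matrix.cons_val_one, Matrix.cons_val] at hA
  have hN : 0 < Nthin ℓ L := Nthin_pos ℓ L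
  have hU : -U4thin ℓ L ≤ 2 * Nthin ℓ L := by
    simp only [U4thin, Nthin] at hA ⊢
    linarith
  rw [thinRatio, div_le_iff₀ hN]
  linarith

/-- **`R4ratio ≥ 0`** (Lebowitz `U₄ ≤ 0` at the dilated tetrahedron, `GG > 0`). [folklore] -/
theorem R4ratio_nonneg (t : ℕ) : 0 ≤ R4ratio t := by
  have hL := softPackageNoBubble_criticalCorr.lebowitz (fun i => (t : ℤ) • tetra i)
  have hU : U4crit t ≤ 0 := by
    simp only [U4crit]
    simpa using hL
  have hG : 0 < GGcrit t := GGcrit_pos t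
  rw [R4ratio]
  exact div_nonneg (by linarith) hG.le

/-- **The crux gives `R4ratio L ≥ c` at every scale `L ≥ 1`** (`latticeBoundFromStrands_proof` ∘ `strandsJoinBound_proof`).
[folklore] -/
theorem R4ratio_ge_of_independentStrandsJoin (h : IndependentStrandsJoin) :
    ∃ c : ℝ, 0 < c ∧ ∀ L : ℕ, 1 ≤ L → c ≤ R4ratio L := by
  obtain ⟨c, hc, hall⟩ :=
    Summit.CriticalPhenomena.Ising3DConformalLimit.FKParityRobustnessLatticeBoundFromStrands.latticeBoundFromStrands_proof
      h Summit.CriticalPhenomena.Ising3DConformalLimit.FKParityRobustnessStrandsJoinBound.strandsJoinBound_proof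
  refine ⟨c, hc, fun L hL => ?_⟩
  have hb : U4crit L ≤ -(c * GGcrit L) := by
    have := hall L hL
    simpa [U4crit, GGcrit, tetra] using this
  have hG : 0 < GGcrit L := GGcrit_pos L
  rw [R4ratio, le_div_iff₀ hG]
  linarith

/-- **Crux ⟹ `OctaveTransfer`** with `C = 2/c`: `thinRatio ≤ 2 = (2/c)·c ≤ (2/c)·R4ratio L ≤ (2/c)·Σ_{j≤ℓ} R4ratio (2^j L)`
(the `j = 0` term, the others being `≥ 0`). [folklore] -/
theorem octaveTransfer_of_independentStrandsJoin (h : IndependentStrandsJoin) : OctaveTransfer := by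
  obtain ⟨c, hc, hR⟩ := R4ratio_ge_of_independentStrandsJoin h
  intro ℓ
  refine ⟨2 / c, by positivity, fun L hL => ?_⟩
  have hsum : R4ratio L ≤ ∑ j ∈ Finset.range (ℓ + 1), R4ratio (2 ^ j * L) := by
    have h0 : (0 : ℕ) ∈ Finset.range (ℓ + 1) := by simp
    have := Finset.single_le_sum (f := fun j => R4ratio (2 ^ j * L)) (fun j _ => R4ratio_nonneg _) h0
    simpa using this
  have hcR : c ≤ R4ratio L := hR L hL
  calc thinRatio ℓ L ≤ 2 := thinRatio_le_two ℓ L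
    _ = 2 / c * c := by field_simp
    _ ≤ 2 / c * R4ratio L := by gcongr
    _ ≤ 2 / c * ∑ j ∈ Finset.range (ℓ + 1), R4ratio (2 ^ j * L) := by gcongr

/-- **Modulo the shared inputs the r2 transfer stub IS the crux**: under `LimitExists`, `EnergyGapPowerLaw` and pinched
transparency, `IndependentStrandsJoin ↔ OctaveTransfer` (← is the landed `independentStrandsJoin_of_limit_gap_pt_oct`).
[folklore] -/
theorem independentStrandsJoin_iff_octaveTransfer (hL : LimitExists) (hgap : EnergyGapPowerLaw)
    (hpt : PinchedTransparencyShape cc2 (criticalCorr 3 4)) :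
    IndependentStrandsJoin ↔ OctaveTransfer :=
  ⟨octaveTransfer_of_independentStrandsJoin, independentStrandsJoin_of_limit_gap_pt_oct hL hgap hpt⟩

end Summit.CriticalPhenomena.Ising3DConformalLimit.Cruxes.IndependentStrandsJoin.PinchToTetra

/-! ## The registered sub-goal `stub_octaveCalibration` -/

namespace Summit.CriticalPhenomena.Ising3DConformalLimit.Theorems

open Summit.CriticalPhenomena.Ising3DConformalLimit.Cruxes.IndependentStrandsJoin.PinchToTetra

/-- **Registered sub-goal `stub_octaveCalibration`** of the crux `IndependentStrandsJoin` (stmt-CriticalPhenomena-14625):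
the crux implies the line's lattice transfer statement `OctaveTransfer`. -/
theorem stub_octaveCalibration : IndependentStrandsJoin → OctaveTransfer :=
  octaveTransfer_of_independentStrandsJoin

end Summit.CriticalPhenomena.Ising3DConformalLimit.Theorems

end
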